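import Summits.Parity.GeneralizedHardyLittlewood.Theorems.PrimeLevelFamEdgeMomentsBeyondDiagonalDiagRemP2TailBound
import Summits.Parity.GeneralizedHardyLittlewood.Theorems.PrimeLevelFamEdgeMomentsBeyondDiagonalDiagRemP2Hyperbola
import Literature.NumberTheory.Sieve.GoldstonYildirimLemma21MoebiusSumProofs
import HarnessLib

/-!
# Route `PrimeLevelFamEdge`, crux K_A `MomentsBeyondDiagonal` (stmt-Parity-20007), line «petersson_layers» v4, stub `stub_diag`:
# **(P2TAIL) and L4, unconditionally** — the Goldston–Yıldırım hypothesis discharged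

`…DiagRemP2TailBound.abs_sum_copTauW_primeSq_sub_le_of` and `…DiagRemP2Hyperbola.sum_moebius_primeSq_hyperbola_asymp_of` with
their hypothesis `goldstonYildirim_lemma21_j0` discharged by the tree's PROVED `Literature.NumberTheory.Sieve.goldstonYildirim_lemma21_j0_holds`.
Separate file only to keep that proofs module out of the import closure of the other bricks.

* `sum_moebius_primeSq_hyperbola_asymp` — `Σ_{de≤z} μ(d)P₂(d)μ(e)/(de) = −1 + O((1+log z)⁻ⁿ)`;
* `abs_sum_copTauW_primeSq_sub_le` — **(P2TAIL): `Σ_{k≤y} a_n(k)P₂(k) = c_n + O(D(n)(1+log y)⁻¹²)`, `|c_n| ≤ C·D(n)`.**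

This closes the (P2TAIL) chain L1–L5 of `Cruxes/MomentsBeyondDiagonal/Lines/petersson_layers_stub_diag_g12_R02_R22.md`: the ONE new
analytic input of the order-`(2,2)` remainder estimate is in the tree; the remaining (2,2) work is bookkeeping (B1–B5 there).
Def-free; theorems only. Helper `--supports stmt-Parity-20007`; closes nothing; K_A, K_B and the Parity summit are NOT proved;
nothing about Landau–Siegel zeros.

## References
* E. Kowalski, P. Michel, J. VanderKam, J. reine angew. Math. 526 (2000), Prop. 5.1 p. 18.
  [cite: KowalskiMichelVanderKam2000, Prop. 5.1 — derivation (P₂-twisted Selberg coefficients)]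
-/

noncomputable section

open Finset Real
open scoped ArithmeticFunction.Moebius

namespace Summit.Parity.GeneralizedHardyLittlewood.Theorems.MomentsBeyondDiagonal.DiagCorner

open Literature.NumberTheory.Sieve (goldstonYildirim_lemma21_j0_holds)
open Summit.Parity.GeneralizedHardyLittlewood.Theorems.BeyondDiagonalBeatsQuarter.KernelFormXSq (copTauW divWeight)

/-- **`Σ_{de ≤ z} μ(d)P₂(d)μ(e)/(de) = −1 + O((1 + log z)⁻ⁿ)`** (every `n`, all `z ≥ 1`), unconditionally.
[cite: MontgomeryVaughan2007, §8.1 — derivation] -/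
theorem sum_moebius_primeSq_hyperbola_asymp (n : ℕ) :
    ∃ K : ℝ, ∀ z : ℝ, 1 ≤ z →
      |(∑ d ∈ Icc 1 ⌊z⌋₊, ∑ e ∈ Icc 1 (⌊z⌋₊ / d),
          (ArithmeticFunction.moebius d : ℝ) / d * (∑ p ∈ d.primeFactors, Real.log p ^ 2) *
            ((ArithmeticFunction.moebius e : ℝ) / e)) + 1| ≤ K / (1 + Real.log z) ^ n :=
  sum_moebius_primeSq_hyperbola_asymp_of goldstonYildirim_lemma21_j0_holds n

/-- **(P2TAIL), unconditionally**: there is `C ≥ 0` such that for every `n ≥ 1` there is `c_n` with `|c_n| ≤ C·D(n)` and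
`|Σ_{k ≤ y} a_n(k)P₂(k) − c_n| ≤ C·D(n)/(1 + log y)¹²` for all `y ≥ 1`.
[cite: KowalskiMichelVanderKam2000, Prop. 5.1 — derivation (P₂-twisted Selberg coefficients)] -/
theorem abs_sum_copTauW_primeSq_sub_le :
    ∃ C : ℝ, 0 ≤ C ∧ ∀ n : ℕ, n ≠ 0 → ∃ c : ℝ, |c| ≤ C * divWeight n ∧ ∀ y : ℝ, 1 ≤ y →
      |(∑ k ∈ Icc 1 ⌊y⌋₊, copTauW n k * ∑ p ∈ k.primeFactors, Real.log p ^ 2) - c| ≤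
        C * divWeight n / (1 + Real.log y) ^ 12 :=
  abs_sum_copTauW_primeSq_sub_le_of goldstonYildirim_lemma21_j0_holds

end Summit.Parity.GeneralizedHardyLittlewood.Theorems.MomentsBeyondDiagonal.DiagCorner

end
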